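import Summits.ABC.StewartYu.ArchG3Rec
import HarnessLib

/-!
# The archimedean record of reference `ArchG3Rec` — schedule laws, zeros gain, orders, `Y₀`-degree, END range

Support file (elementary theorems; no named facts). Cell `abc-stewartyu`, route `YuMatveevShapeRat`, crux r2 `ArchCoreRat`
(stmt-ABC-20502, plan R32 one-stage); seat p1 (record owner). Continues `ArchG3Rec` (print's CAPPED schedule):
`Xs s ≤ 2^{s−1}X + 1` and `Xs s ≤ 4XL/(T s+1) + 1`, `8L/2^s < T_s + 1`, **`4·X·L ≤ Xs s·(T_s+1)`** and
**`8·2^ν·Z ≤ zeros s ν`** at every level (floor or not), the order laws `Mord s ν = Mord s (ν+1) + T s`,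
`Mord s (n+1) = Mord (s+1) 0`, `M/(n+2)³ ≤ Mord`, the `L₀`, `D₀`, `D`, `H` floors, and the END range fact
**`2^{n+22}·X ≤ Xs Ŝ`** (print (5.12), N-free).

## References
* [Nesterenko2003] Yu. V. Nesterenko, LNM 1819 (2003) — (4.3)–(4.5), (4.24)–(4.25), §5.2 (5.6), (5.12).
-/

noncomputable section

open Finset Real

namespace Summit.ABC.StewartYu

namespace ArchG3Rec

open PadicG3Par (cG cM Cb cG_pos Cb_pos)
open ArchG3Par (G K SdK yloadK G_eq eight_le_G G_pos one_le_K K_pos two_G_le_yloadK yloadK_pos)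

variable {n : ℕ} (P : ArchG3Rec n)

/-! ### The schedule -/

/-- `1 ≤ T s ≤ 8L` and `8L/2^s ≤ T s`. [folklore] -/
theorem T_facts (s : ℕ) : 1 ≤ P.T s ∧ P.T s ≤ 8 * P.L ∧ 8 * P.L / 2 ^ s ≤ P.T s := by
  refine ⟨by unfold T; exact le_max_left _ _, ?_, by unfold T; exact le_max_right _ _⟩
  unfold T
  refine max_le ?_ (Nat.div_le_self _ _)
  have := P.L_floors.1
  have : 1 ≤ P.L := le_trans Nat.one_le_two_pow this
  omega

/-- `8L/2^s ≤ T s`. [folklore] -/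
theorem div_le_T (s : ℕ) : 8 * P.L / 2 ^ s ≤ P.T s := (P.T_facts s).2.2

/-- the doubling cap: `Xs s ≤ 2^s X/2 + 1`. [cite: Nesterenko2003, (4.3)] -/
theorem Xs_le_dbl (s : ℕ) : (P.Xs s : ℝ) ≤ 2 ^ s * P.X / 2 + 1 := by
  have e : (2 : ℝ) ^ s * G n * P.X / (16 * (n + 1)) = 2 ^ s * P.X / 2 := by
    rw [G_eq]; field_simp; ring
  have h0 : 0 ≤ (2 : ℝ) ^ s * G n * P.X / (16 * (n + 1)) := by have := G_pos n; positivity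
  have h1 : P.Xs s ≤ ⌊(2 : ℝ) ^ s * G n * P.X / (16 * (n + 1))⌋₊ + 1 := by unfold Xs; exact min_le_left _ _
  have h1' : (P.Xs s : ℝ) ≤ ((⌊(2 : ℝ) ^ s * G n * P.X / (16 * (n + 1))⌋₊ + 1 : ℕ) : ℝ) := by exact_mod_cast h1
  push_cast at h1'
  rw [← e]
  linarith [Nat.floor_le h0]

/-- the print cap: `1 ≤ Xs s ≤ 4XL/(T s + 1) + 1` (in `ℕ`). [cite: Nesterenko2003, (4.3)] -/
theorem Xs_cap_facts (s : ℕ) : 1 ≤ P.Xs s ∧ P.Xs s ≤ 4 * P.X * P.L / (P.T s + 1) + 1 := by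
  unfold Xs; exact ⟨le_min (Nat.le_add_left 1 _) (Nat.le_add_left 1 _), min_le_right _ _⟩

/-- `8L/2^s < T s + 1`. [cite: Nesterenko2003, (4.3)] -/
theorem T_add_one_gt (s : ℕ) : (8 : ℝ) * P.L / 2 ^ s < P.T s + 1 := by
  have h1 : 8 * P.L / 2 ^ s ≤ P.T s := P.div_le_T s
  have h2 := Nat.lt_div_mul_add (a := 8 * P.L) (b := 2 ^ s) (by positivity)
  have h3 : 8 * P.L < (P.T s + 1) * 2 ^ s := by
    calc 8 * P.L < 8 * P.L / 2 ^ s * 2 ^ s + 2 ^ s := h2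
      _ = (8 * P.L / 2 ^ s + 1) * 2 ^ s := by ring
      _ ≤ (P.T s + 1) * 2 ^ s := Nat.mul_le_mul_right _ (by omega)
  have h3' : ((8 * P.L : ℕ) : ℝ) < (((P.T s + 1) * 2 ^ s : ℕ) : ℝ) := by exact_mod_cast h3
  push_cast at h3'
  rw [div_lt_iff₀ (by positivity)]
  linarith

/-- **`4 X L ≤ Xs s·(T s + 1)`** at every level (doubling branch: `2^s X/2 · 8L/2^s`; capped branch: by definition).
[cite: Nesterenko2003, (4.3), (4.25)] -/
theorem Xs_mul_ge (s : ℕ) : 4 * (P.X : ℝ) * P.L ≤ (P.Xs s : ℝ) * (P.T s + 1) := by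
  have hT : (0 : ℝ) < P.T s + 1 := by positivity
  rcases min_choice (⌊(2 : ℝ) ^ s * G n * P.X / (16 * (n + 1))⌋₊ + 1) (4 * P.X * P.L / (P.T s + 1) + 1) with h | h
  · -- doubling branch
    have hXs : (P.Xs s : ℝ) = ((⌊(2 : ℝ) ^ s * G n * P.X / (16 * (n + 1))⌋₊ + 1 : ℕ) : ℝ) := by
      unfold Xs; exact_mod_cast h
    have hgt : (2 : ℝ) ^ s * P.X / 2 < P.Xs s := by
      have h' := Nat.lt_floor_add_one ((2 : ℝ) ^ s * G n * P.X / (16 * (n + 1)))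
      have e : (2 : ℝ) ^ s * G n * P.X / (16 * (n + 1)) = 2 ^ s * P.X / 2 := by
        rw [G_eq]; field_simp; ring
      rw [hXs]; push_cast; rw [← e]; exact h'
    have h2 := P.T_add_one_gt s
    have ha : 0 ≤ (2 : ℝ) ^ s * P.X / 2 := by positivity
    have hb : 0 ≤ (8 : ℝ) * P.L / 2 ^ s := by positivity
    calc 4 * (P.X : ℝ) * P.L = (2 ^ s * P.X / 2) * (8 * P.L / 2 ^ s) := by field_simp; ring
      _ ≤ (P.Xs s : ℝ) * (P.T s + 1) := mul_le_mul hgt.le h2.le hb (by positivity)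
  · -- capped branch: `(4XL/(T+1) + 1)(T+1) > 4XL`
    have hXs : P.Xs s = 4 * P.X * P.L / (P.T s + 1) + 1 := by unfold Xs; exact h
    have hlt := Nat.lt_div_mul_add (a := 4 * P.X * P.L) (b := P.T s + 1) (by omega)
    have h3 : 4 * P.X * P.L ≤ (4 * P.X * P.L / (P.T s + 1) + 1) * (P.T s + 1) := by
      calc 4 * P.X * P.L ≤ 4 * P.X * P.L / (P.T s + 1) * (P.T s + 1) + (P.T s + 1) := hlt.le
        _ = (4 * P.X * P.L / (P.T s + 1) + 1) * (P.T s + 1) := by ring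
    have h3' : ((4 * P.X * P.L : ℕ) : ℝ) ≤ (((4 * P.X * P.L / (P.T s + 1) + 1) * (P.T s + 1) : ℕ) : ℝ) := by
      exact_mod_cast h3
    rw [hXs]; push_cast at h3' ⊢; linarith

/-- **the END range (print (5.12)): `2^{n+22}·X ≤ Xs Ŝ`**, N-free (doubling branch: `2^{Ŝ−1} ≥ 2^{n+23}`; capped
branch: `4XL/(T+1) ≥ min(2^{Ŝ−2}X, 2XL)` and `L ≥ 2^{n+25}`). [cite: Nesterenko2003, §5.2 (5.6), (5.12)] -/
theorem Xs_Sd_ge : (2 : ℝ) ^ (n + 22) * P.X ≤ P.Xs P.Sd := by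
  have h4 := P.Xs_mul_ge P.Sd
  have hS := P.Sd_bounds.2.2
  have hL := P.L_real.2.2.1
  have hX : (0 : ℝ) < P.X := by linarith [P.X_floors.2.1]
  -- `T Ŝ + 1 ≤ 8L/2^Ŝ + 2 ≤ 8L/2^{n+24} + 2`, and `Xs·(T+1) ≥ 4XL`
  have hT : (P.T P.Sd : ℝ) ≤ 8 * P.L / 2 ^ P.Sd + 1 := by
    have h1 : P.T P.Sd ≤ 8 * P.L / 2 ^ P.Sd + 1 := by
      unfold T; exact max_le (Nat.le_add_left 1 _) (Nat.le_succ _)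
    have h2 : ((8 * P.L / 2 ^ P.Sd : ℕ) : ℝ) ≤ 8 * (P.L : ℝ) / 2 ^ P.Sd := by
      have h := Nat.cast_div_le (m := 8 * P.L) (n := 2 ^ P.Sd) (α := ℝ)
      push_cast at h
      exact h
    have h1' : (P.T P.Sd : ℝ) ≤ ((8 * P.L / 2 ^ P.Sd : ℕ) : ℝ) + 1 := by exact_mod_cast h1
    linarith
  have h2S : (2 : ℝ) ^ (n + 24) ≤ 2 ^ P.Sd := pow_le_pow_right₀ (by norm_num) hS
  have hq : 8 * (P.L : ℝ) / 2 ^ P.Sd ≤ 8 * P.L / 2 ^ (n + 24) := by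
    exact div_le_div_of_nonneg_left (by positivity) (by positivity) h2S
  -- `Xs ≥ 4XL/(T+1) ≥ 4XL/(8L/2^{n+24} + 2)`; and `4L/(8L/2^{n+24}+2) ≥ 2^{n+22}` iff `4L ≥ 2^{n+25}L/2^{n+24}... ` use `L ≥ 2^{n+25}`
  have hden : (P.T P.Sd : ℝ) + 1 ≤ 8 * P.L / 2 ^ (n + 24) + 2 := by linarith
  have hden0 : (0 : ℝ) < P.T P.Sd + 1 := by positivity
  have hXs0 : (0 : ℝ) ≤ P.Xs P.Sd := Nat.cast_nonneg _
  -- from h4: Xs ≥ 4XL/(T+1)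
  have h5 : 4 * (P.X : ℝ) * P.L / (8 * P.L / 2 ^ (n + 24) + 2) ≤ P.Xs P.Sd := by
    rw [div_le_iff₀ (by positivity)]
    calc 4 * (P.X : ℝ) * P.L ≤ (P.Xs P.Sd : ℝ) * (P.T P.Sd + 1) := h4
      _ ≤ (P.Xs P.Sd : ℝ) * (8 * P.L / 2 ^ (n + 24) + 2) := mul_le_mul_of_nonneg_left hden hXs0
  refine le_trans ?_ h5
  rw [le_div_iff₀ (by positivity)]
  -- `2^{n+22} X (8L/2^{n+24} + 2) = 2XL + 2^{n+23}X ≤ 4XL` as `2^{n+23} ≤ 2L`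
  have e : (2 : ℝ) ^ (n + 22) * P.X * (8 * P.L / 2 ^ (n + 24) + 2) = 2 * P.X * P.L + 2 ^ (n + 23) * P.X := by
    rw [pow_add, pow_add]; field_simp; ring
  rw [e]
  have h25 : (2 : ℝ) ^ (n + 23) ≤ P.L := le_trans (pow_le_pow_right₀ (by norm_num) (by omega)) hL
  nlinarith

/-- **`8 · 2^ν · Z ≤ zeros s ν`** at every stage. [cite: Nesterenko2003, (4.25)] -/
theorem zeros_ge (s ν : ℕ) : 8 * 2 ^ ν * P.Z ≤ P.zeros s ν := by
  unfold zeros Z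
  have h := P.Xs_mul_ge s
  have hG := G_pos n
  have h2 : (0 : ℝ) < 2 ^ ν := by positivity
  have e : G n * (2 ^ (ν + 1) * (P.Xs s : ℝ)) * (P.T s + 1) = 2 * 2 ^ ν * G n * ((P.Xs s : ℝ) * (P.T s + 1)) := by
    rw [pow_succ]; ring
  rw [e]
  nlinarith [mul_pos h2 hG]

/-- the in-level decrement law `Mord s ν = Mord s (ν+1) + T s` for `ν ≤ n`. [cite: Nesterenko2003, (4.5)] -/
theorem Mord_sub_succ (s ν : ℕ) (hν : ν ≤ n) : P.Mord s ν = P.Mord s (ν + 1) + P.T s := by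
  unfold Mord
  have : n + 1 - ν = (n + 1 - (ν + 1)) + 1 := by omega
  rw [this]; ring

/-- `R s = T s + R (s+1)` for `s ≤ Ŝ`. [folklore] -/
theorem R_eq_add (s : ℕ) (hs : s ≤ P.Sd) : P.R s = P.T s + P.R (s + 1) := by
  unfold R
  rw [← Finset.sum_Ioc_add_eq_sum_Icc hs, add_comm, Finset.Icc_add_one_left_eq_Ioc]

/-- `R s = 0` beyond the depth. [folklore] -/
theorem R_eq_zero (s : ℕ) (hs : P.Sd < s) : P.R s = 0 := by
  unfold R; rw [Finset.Icc_eq_empty (by omega), Finset.sum_empty]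

/-- the level law `Mord s (n+1) = Mord (s+1) 0` for `s < Ŝ`. [cite: Nesterenko2003, (4.5)] -/
theorem Mord_level (s : ℕ) (hs : s + 1 ≤ P.Sd) : P.Mord s (n + 1) = P.Mord (s + 1) 0 := by
  unfold Mord
  rw [P.R_eq_add (s + 1) hs]
  simp only [Nat.sub_self, zero_mul, add_zero, Nat.sub_zero]
  ring

/-- the order floor at every stage: `M/(n+2)³ ≤ Mord s ν` and `(n+1−ν)·T s ≤ Mord s ν`. [cite: Nesterenko2003, (4.5)] -/
theorem Mord_facts (s ν : ℕ) : P.M / (n + 2) ^ 3 ≤ P.Mord s ν ∧ (n + 1 - ν) * P.T s ≤ P.Mord s ν := by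
  unfold Mord; exact ⟨by omega, Nat.le_add_left _ _⟩

/-! ### The `Y₀`-degree -/

/-- `6 X C_bⁿ Ω K/N ≤ L₀`. [folklore] -/
theorem L₀_ge : 6 * P.X * Cb ^ n * P.Ω * K n / P.N ≤ P.L₀ := by unfold L₀; exact Nat.le_ceil _

/-- `L₀ < 6 X C_bⁿ Ω K/N + 1`. [folklore] -/
theorem L₀_lt : (P.L₀ : ℝ) < 6 * P.X * Cb ^ n * P.Ω * K n / P.N + 1 := by
  unfold L₀
  refine Nat.ceil_lt_add_one ?_
  have := P.Ω_facts.1; have := K_pos n; have := Cb_pos; have := P.N_facts.1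
  positivity

/-- the END floors: `1 ≤ D₀`, `1 ≤ D j`, `1 ≤ H`, `1 ≤ L₀ + 1`. [folklore] -/
theorem end_floors : 1 ≤ P.D₀ ∧ (∀ j, 1 ≤ P.D j) ∧ 1 ≤ P.H := by
  refine ⟨by unfold D₀; omega, fun j => by unfold D; omega, by unfold H; exact le_max_left _ _⟩

end ArchG3Rec

end Summit.ABC.StewartYu
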